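import Summits.BirchSwinnertonDyer.BirchSwinnertonDyer.Theorems.GenusKolyvaginAtTwoPowDvdShaCardAtTwoPosTRankLeOnePosCut
import Summits.BirchSwinnertonDyer.BirchSwinnertonDyer.Theorems.GenusKolyvaginAtTwoShaCardDvdPowAtTwoPosT
import Summits.BirchSwinnertonDyer.BirchSwinnertonDyer.Theorems.GenusKolyvaginAtTwoPowDvdShaCardAtTwoPosT
import Summits.BirchSwinnertonDyer.BirchSwinnertonDyer.Theorems.GenusKolyvaginAtTwoOffCutResidualAtTwoRLw2FlatPosSharpExponent
import Summits.BirchSwinnertonDyer.BirchSwinnertonDyer.Theorems.GenusKolyvaginAtTwoOffCutResidualAtTwoRLw2FlatPosSockets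
import Summits.BirchSwinnertonDyer.BirchSwinnertonDyer.Theorems.GenusKolyvaginAtTwoShaCardDvdPowAtTwoPosTOnCut
import HarnessLib

/-!
# Route `GenusKolyvaginAtTwo`, LINE 26 «lw2_phantom_exclusion» of the residual crux `OffCutResidualAtTwoR` (stmt-BirchSwinnertonDyer-31767):
# the FLAT re-thread — part G2: **R⁺, U⁺_T′, L⁺_T′ and Q4_T″ — LINE 26 stub `stub_Q4flat` PROVED VERBATIM — from `(NPh at 2N)` instead of an odd multiplicative prime**

Seat `bsd-line-gk2-p5` g40 (WIDTH-5 attach, cell `bsd-f1-sign2`), `--supports stmt-BirchSwinnertonDyer-31767` (helper; closes nothing).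
THEOREMS ONLY (no definition, no named fact, no `sorry`).  **BSD is NOT proved by any of this**; the residual crux is NOT closed by it.
Same surgery as parts A1/A2 (`…Lw2FlatRankDescent`, `…Lw2FlatSharpExponentRat`; see their module docstrings): the binder quadruple
`(v) (h2v) (hNv) (hmult)` of the landed Q3R_T / Q4_T″ cone is replaced by the hypothesis `hNPh : (NPh at 2N)(E, K)` (VERBATIM the conclusion of
`GenusExact.NonPhantomPow.nonPhantomAtTwo_of_hasMultiplicativeReductionAt`), inserted after the two `¬ IsSquare` clauses; proofs are the landed
ones verbatim with `_flat` callees; decl names = originals + `_flat`; namespaces unchanged.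

WHAT (this part).  The top of the Q4_T″ cone (Δ>0, transposition-type Kolyvagin primes): `mordellWeilRank_baseChange_le_one_onPosCut` (R⁺), U⁺_T′
(`shaCardDvdPowAtTwoPosT_proof`, via the public engine `PlusDescent.natCard_primaryComponent_sha_two_dvd_pow_onOddTwinCut_of_selmerExponent` of
`…PosTOnCut`), L⁺_T′ (`powDvdShaCardAtTwoPosT_proof`, road (E4)⁺), and **`Lw2PhantomExclusion.q4flat` = LINE 26 STUB `stub_Q4flat` VERBATIM**
(`#Ш(E/K)[2^∞] = 2^(2M₀)` on the Δ>0 cut with `(NPh at 2N)(E, K)` in place of the odd multiplicative prime).  Imports parts F and G1.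
-/

set_option autoImplicit false
-- the Theorems namespace of this sub repeats the summit name by design (D-0017 nested layout)
set_option linter.dupNamespace false

noncomputable section

/-! ## from `GenusKolyvaginAtTwoPowDvdShaCardAtTwoPosTRankLeOnePosCut` -/

open scoped Classical

namespace Summit.BirchSwinnertonDyer.BirchSwinnertonDyer.Theorems.GenusExact.PlusDescent

open Literature.NumberTheory.EllipticCurves Literature.NumberTheory.GaloisRepresentations WeierstrassCurve NumberField
  IsDedekindDomain Field AddSubgroup Literature.NumberTheory.EllipticCurves.ModularForms
  Literature.NumberTheory.EllipticCurves.RingClassField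
open Summit.BirchSwinnertonDyer.Rank1Residual
open Summit.BirchSwinnertonDyer.BirchSwinnertonDyer.Theses.GenusKolyvaginAtTwo (KolyvaginRelationAtTwo)

/-- (LINE 26 FLAT form: the hypothesis `(NPh at 2N)(E, K)` replaces the odd multiplicative prime `v`.) **STUB R⁺ of the (E4)⁺ skeleton, CLOSED: `rank E(K) ≤ 1` on the cut of L⁺_T′** (signature = `stub_rankLeOnePosCut` of
`Cruxes/PowDvdShaCardAtTwoPosT/Lines/plus_descent_e4pos.lean` VERBATIM).  B2Q⁺ by name ⟹ `rank E(ℚ) = 0` ⟹ `rank E(K) = rank E(ℚ) + rank E^{d_K}(ℚ) ≤ 1`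
(`#Sel₂(Wd) = 2`).  No sign of `Δ` is used (the hypotheses `v`, non-squares, … only feed B2Q⁺). (Rank bookkeeping adapted from gk2-p3 g27's
`exists_frame_of_cut`.) [cite: Kolyvagin1989Izv, Thm. B₂] [cite: Kramer1981, Thm. 1] [cite: SilvermanAEC2009, Thm. X.4.2 (a)] -/
theorem mordellWeilRank_baseChange_le_one_onPosCut_flat : KolyvaginRelationAtTwo → ∀ (W : WeierstrassCurve ℚ) [W.IsElliptic] [W.IsGloballyMinimal]
    [NeZero (W.conductorNorm ℤ)],
    ¬ W.HasCM → Odd W.tamagawaProduct → ∀ (K : Type) [Field K] [NumberField K], IsImaginaryQuadratic K → Odd (NumberField.discr K) → NumberField.discr K ≠ -3 →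
    SatisfiesHeegnerHypothesis (W.conductorNorm ℤ) K → ¬ IsSquare ((NumberField.discr K : ℚ) * -|W.Δ|) →
    ¬ IsSquare ((NumberField.discr K : ℚ) * (-(2 * |W.Δ|))) →
    (∀ (Mlev : ℕ), 1 ≤ Mlev → ∀ z : galH1Torsion (W.baseChange K) ((2 ^ Mlev : ℕ) : ℤ),
          (∀ ρ ∈ torsionFixing (W.baseChange K) ((2 ^ Mlev : ℕ) : ℤ), h1Eval (W.baseChange K) ((2 ^ Mlev : ℕ) : ℤ) z ρ = 0) →
          (∀ w : HeightOneSpectrum (𝓞 K), ((2 * W.conductorNorm ℤ : ℕ) : 𝓞 K) ∈ w.asIdeal →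
            z ∈ selmerLocalKer (W.baseChange K) (w.adicCompletion K) ((2 ^ Mlev : ℕ) : ℤ)) → z = 0) → (∀ n : ℕ, 0 < n → W.HasSurjectiveModNGaloisRep ((2 : ℤ) ^ n)) →
    ∀ (Dt : ModularParametrizationData W (W.conductorNorm ℤ)) (β : ℤ) (ι : K →+* ℂ) (d₁ : KolyvaginHeegnerData Dt β ι 1),
    ¬ IsOfFinAddOrder d₁.derivedPoint → ∀ (M₀ : ℕ),
    (¬ ∃ Q : (W.baseChange (ringClassField K ι 1)).toAffine.Point, ((2 ^ (M₀ + 1) : ℕ) : ℤ) • Q = d₁.derivedPoint) →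
    W.rootNumber = 1 → ∀ (Wd : WeierstrassCurve ℚ) [Wd.IsElliptic] [Wd.IsGloballyMinimal],
    (∃ C : VariableChange ℚ, C • W.quadraticTwist (NumberField.discr K : ℚ) = Wd) → Nat.card (Wd.selmerGroup 2) = 2 →
    (W.baseChange K).mordellWeilRank ≤ 1 := by
  intro hQ2 W _ _ _ hcm hT K _ _ hIQ hodd h3 hHe hsq1 hsq2 hNPh hρ Dt β ι d₁ _hy M₀ hndiv hw Wd _ _ hWd hSel
  -- `rank E(ℚ) = 0` from B2Q⁺ (Kummer)
  have hB2Q := stub_b2qSignFree_flat hQ2 W hcm hT K hIQ hodd h3 hHe hsq1 hsq2 hNPh hρ Dt β ι d₁ M₀ hndiv hw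
  have hrk0 : W.mordellWeilRank = 0 := mordellWeilRank_eq_zero_of_two_pow_smul_selmer_eq_zero W (hB2Q (M₀ + 1))
  -- the twist `T = E^{d_K}` and `#Sel₂(T) = 2`
  have h2 : Module.finrank ℚ K = 2 := hIQ.1
  have hdK : (NumberField.discr K : ℚ) ≠ 0 := by exact_mod_cast NumberField.discr_ne_zero K
  haveI hTell : (W.quadraticTwist (NumberField.discr K : ℚ)).IsElliptic := W.isElliptic_quadraticTwist hdK
  set T := W.quadraticTwist (NumberField.discr K : ℚ) with hTdef
  haveI : Module.Finite ℤ (W.baseChange K).toAffine.Point := (W.baseChange K).module_finite_point_holds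
  have hsum : (W.baseChange K).mordellWeilRank = W.mordellWeilRank + T.mordellWeilRank :=
    W.mordellWeilRank_baseChange_of_finrank_eq_two_of_finite K h2
  obtain ⟨Cd, hCd⟩ := hWd
  have hSelT : Nat.card (T.selmerGroup 2) = 2 := by
    have h := natCard_selmerGroup_smul T Cd (n := 2) two_ne_zero
    simp only [Nat.cast_ofNat] at h
    rw [← h, hCd, hSel]
  -- the descent count for `T`: `2 = 2^(rank T) · #T(ℚ)[2] · #(Ш ⊓ H¹[2])` forces `rank T ≤ 1`
  have hcount := card_selmerGroup_eq_pow_rank_mul T 2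
  simp only [Nat.cast_ofNat] at hcount
  rw [hSelT] at hcount
  have hrkT : T.mordellWeilRank ≤ 1 := by
    have hdvd : 2 ^ T.mordellWeilRank ∣ 2 := Dvd.intro _ (by rw [mul_assoc] at hcount; exact hcount.symm)
    have hle := Nat.le_of_dvd two_pos hdvd
    by_contra h
    have h4 : 4 ≤ 2 ^ T.mordellWeilRank := by
      calc 4 = 2 ^ 2 := by norm_num
        _ ≤ 2 ^ T.mordellWeilRank := Nat.pow_le_pow_right (by norm_num) (by omega)
    omega
  rw [hsum, hrk0, zero_add]
  exact hrkT

end Summit.BirchSwinnertonDyer.BirchSwinnertonDyer.Theorems.GenusExact.PlusDescent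

/-! ## from `GenusKolyvaginAtTwoShaCardDvdPowAtTwoPosT` -/

open scoped Classical

namespace Summit.BirchSwinnertonDyer.BirchSwinnertonDyer.Theorems

open Summit.BirchSwinnertonDyer.BirchSwinnertonDyer.Theses.GenusKolyvaginAtTwo
open Summit.BirchSwinnertonDyer.BirchSwinnertonDyer.Theorems.GenusExact.PlusDescent
open Literature.NumberTheory.EllipticCurves Literature.NumberTheory.GaloisRepresentations WeierstrassCurve NumberField
  IsDedekindDomain Field AddSubgroup Literature.NumberTheory.EllipticCurves.ModularForms
  Literature.NumberTheory.EllipticCurves.RingClassField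

/-- (LINE 26 FLAT form: the hypothesis `(NPh at 2N)(E, K)` replaces the odd multiplicative prime `v`.) **U⁺_T′ `ShaCardDvdPowAtTwoPosT` (stmt-BirchSwinnertonDyer-25500) PROVED BY NAME**: given Q2, on the Δ>0 odd-Tamagawa habitat with an odd
multiplicative prime, `w(E) = 1` and a globally minimal 2-Selmer-minimal twin model with `ord₂ c(Wd) = 0`, `#Ш(E/K)[2^∞] ∣ 2^(2M₀)` — the
descent on the odd-twin cut (gk2-p3 g27, private §0–§1 above) fed by Kolyvagin's Theorem B₂ at 2 over `ℚ`, sign-free (gk2-p5 g31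
`stub_b2qSignFree_flat`).  BSD is NOT proved by this; Q4_T″ is NOT proved by this.
[cite: McCallumLMS1991, §5 Cor. 5.6] [cite: Kolyvagin1989Izv, Thm. B₂] [cite: Kramer1981, Thm. 1] [cite: MazurRubin2010, Cor. 3.4 (i)] -/
theorem shaCardDvdPowAtTwoPosT_proof_flat :
    KolyvaginRelationAtTwo → ∀ (W : WeierstrassCurve ℚ) [W.IsElliptic] [W.IsGloballyMinimal] [NeZero (W.conductorNorm ℤ)], ¬ W.HasCM → Odd W.tamagawaProduct → 0 < W.Δ → ∀ (K : Type) [Field K] [NumberField K], Literature.NumberTheory.EllipticCurves.IsImaginaryQuadratic K → Odd (NumberField.discr K) → NumberField.discr K ≠ -3 → Literature.NumberTheory.EllipticCurves.SatisfiesHeegnerHypothesis (W.conductorNorm ℤ) K → ¬ IsSquare ((NumberField.discr K : ℚ) * -|W.Δ|) → ¬ IsSquare ((NumberField.discr K : ℚ) * (-(2 * |W.Δ|))) →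
    (∀ (Mlev : ℕ), 1 ≤ Mlev → ∀ z : galH1Torsion (W.baseChange K) ((2 ^ Mlev : ℕ) : ℤ),
          (∀ ρ ∈ torsionFixing (W.baseChange K) ((2 ^ Mlev : ℕ) : ℤ), h1Eval (W.baseChange K) ((2 ^ Mlev : ℕ) : ℤ) z ρ = 0) →
          (∀ w : HeightOneSpectrum (𝓞 K), ((2 * W.conductorNorm ℤ : ℕ) : 𝓞 K) ∈ w.asIdeal →
            z ∈ selmerLocalKer (W.baseChange K) (w.adicCompletion K) ((2 ^ Mlev : ℕ) : ℤ)) → z = 0) → (∀ n : ℕ, 0 < n → W.HasSurjectiveModNGaloisRep ((2 : ℤ) ^ n)) → ∀ (Dt : Literature.NumberTheory.EllipticCurves.ModularForms.ModularParametrizationData W (W.conductorNorm ℤ)) (β : ℤ) (ι : K →+* ℂ) (d₁ : Literature.NumberTheory.EllipticCurves.KolyvaginHeegnerData Dt β ι 1), ¬ IsOfFinAddOrder d₁.derivedPoint → ∀ (M₀ : ℕ), (∃ Q : (W.baseChange (Literature.NumberTheory.EllipticCurves.ringClassField K ι 1)).toAffine.Point, ((2 ^ M₀ : ℕ) : ℤ)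 • Q = d₁.derivedPoint) → (¬ ∃ Q : (W.baseChange (Literature.NumberTheory.EllipticCurves.ringClassField K ι 1)).toAffine.Point, ((2 ^ (M₀ + 1) : ℕ) : ℤ) • Q = d₁.derivedPoint) → W.rootNumber = 1 → ∀ (Wd : WeierstrassCurve ℚ) [Wd.IsElliptic] [Wd.IsGloballyMinimal], (∃ C : WeierstrassCurve.VariableChange ℚ, C • W.quadraticTwist (NumberField.discr K : ℚ) = Wd) → Nat.card (Wd.selmerGroup 2) = 2 → padicValNat 2 Wd.tamagawaProduct = 0 → Nat.card (AddCommGroup.primaryComponent (W.baseChange K).sha 2) ∣ 2 ^ (2 * M₀) := by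
  intro hQ2 W _ _ _ hcm hT hpos K _ _ hIQ hodd h3 hHe hsq1 hsq2 hNPh hρ Dt β ι d₁ hy M₀ _hdiv hndiv hw Wd _ _ hWd hSel hTam
  have hs2 : W.HasSurjectiveModNGaloisRep 2 := by simpa using hρ 1 one_pos
  exact GenusExact.PlusDescent.natCard_primaryComponent_sha_two_dvd_pow_onOddTwinCut_of_selmerExponent W K hT hpos hIQ hodd
    hHe hs2 Dt β ι d₁ hy M₀ hndiv hw Wd hWd hSel hTam
    (fun M s₀ hs₀ ↦ stub_b2qSignFree_flat hQ2 W hcm hT K hIQ hodd h3 hHe hsq1 hsq2 hNPh hρ Dt β ι d₁ M₀ hndiv hw M s₀ hs₀)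

end Summit.BirchSwinnertonDyer.BirchSwinnertonDyer.Theorems

/-! ## from `GenusKolyvaginAtTwoPowDvdShaCardAtTwoPosT` -/

open scoped Classical
open scoped AddSubgroup
open Function Field NumberField IsDedekindDomain WeierstrassCurve
open Literature.NumberTheory.EllipticCurves Literature.NumberTheory.GaloisRepresentations
open Literature.NumberTheory.EllipticCurves.ModularForms
open Literature.NumberTheory.GaloisCohomology
open Summit.BirchSwinnertonDyer.Rank1Residual.JET.GlobalDuality
open Summit.BirchSwinnertonDyer.BirchSwinnertonDyer.Theses.GenusKolyvaginAtTwo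
open Summit.BirchSwinnertonDyer.Rank1Residual
open Summit.BirchSwinnertonDyer.BirchSwinnertonDyer.Theorems.GenusExact.PlusDescent

namespace Summit.BirchSwinnertonDyer.BirchSwinnertonDyer.Theorems

/-- (LINE 26 FLAT form: the hypothesis `(NPh at 2N)(E, K)` replaces the odd multiplicative prime `v`.) **L⁺_T′ `PowDvdShaCardAtTwoPosT` (stmt-BirchSwinnertonDyer-25501) PROVED: on the Δ>0 cut of the route's habitat, from Q2, `2^(2M₀) ∣ #Ш(E/K)[2^∞]`** —
the lower half of Kolyvagin's structure theorem at `p = 2` with TRANSPOSITION-type Kolyvagin primes.  Road (E4)⁺ by name (see the module docstring for the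
cone and the owners of each socket).  BSD is NOT proved by this; neither is Q4_T″ (one line away) nor the route's deciding theorem.
[cite: McCallumLMS1991, §5 Prop. 5.2, Thm. 5.4 (p. 310)] [cite: Kolyvagin1991StructureSha] [cite: Kolyvagin1991MathAnn, Thm. 2.1–2.2] [cite: GrossLMS1991, §1 Thm. 1.3, §10]
[cite: Kramer1981, Thm. 1] -/
theorem powDvdShaCardAtTwoPosT_proof_flat :
    KolyvaginRelationAtTwo → ∀ (W : WeierstrassCurve ℚ) [W.IsElliptic] [W.IsGloballyMinimal] [NeZero (W.conductorNorm ℤ)], ¬ W.HasCM → Odd W.tamagawaProduct → 0 < W.Δ → ∀ (K : Type) [Field K] [NumberField K], Literature.NumberTheory.EllipticCurves.IsImaginaryQuadratic K → Odd (NumberField.discr K) → NumberField.discr K ≠ -3 → Literature.NumberTheory.EllipticCurves.SatisfiesHeegnerHypothesis (W.conductorNorm ℤ) K → ¬ IsSquare ((NumberField.discr K : ℚ) * -|W.Δ|) → ¬ IsSquare ((NumberField.discr K : ℚ) * (-(2 * |W.Δ|))) →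
    (∀ (Mlev : ℕ), 1 ≤ Mlev → ∀ z : galH1Torsion (W.baseChange K) ((2 ^ Mlev : ℕ) : ℤ),
          (∀ ρ ∈ torsionFixing (W.baseChange K) ((2 ^ Mlev : ℕ) : ℤ), h1Eval (W.baseChange K) ((2 ^ Mlev : ℕ) : ℤ) z ρ = 0) →
          (∀ w : HeightOneSpectrum (𝓞 K), ((2 * W.conductorNorm ℤ : ℕ) : 𝓞 K) ∈ w.asIdeal →
            z ∈ selmerLocalKer (W.baseChange K) (w.adicCompletion K) ((2 ^ Mlev : ℕ) : ℤ)) → z = 0) → (∀ n : ℕ, 0 < n → W.HasSurjectiveModNGaloisRep ((2 : ℤ) ^ n)) → ∀ (Dt : Literature.NumberTheory.EllipticCurves.ModularForms.ModularParametrizationData W (W.conductorNorm ℤ)) (β : ℤ) (ι : K →+* ℂ) (d₁ : Literature.NumberTheory.EllipticCurves.KolyvaginHeegnerData Dt β ι 1), ¬ IsOfFinAddOrder d₁.derivedPoint → ∀ (M₀ : ℕ), (∃ Q : (W.baseChange (Literature.NumberTheory.EllipticCurves.ringClassField K ι 1)).toAffine.Point, ((2 ^ M₀ : ℕ) : ℤ)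 • Q = d₁.derivedPoint) → (¬ ∃ Q : (W.baseChange (Literature.NumberTheory.EllipticCurves.ringClassField K ι 1)).toAffine.Point, ((2 ^ (M₀ + 1) : ℕ) : ℤ) • Q = d₁.derivedPoint) → W.rootNumber = 1 → ∀ (Wd : WeierstrassCurve ℚ) [Wd.IsElliptic] [Wd.IsGloballyMinimal], (∃ C : WeierstrassCurve.VariableChange ℚ, C • W.quadraticTwist (NumberField.discr K : ℚ) = Wd) → Nat.card (Wd.selmerGroup 2) = 2 → padicValNat 2 Wd.tamagawaProduct = 0 → ∀ (n : ℕ) (d : Literature.NumberTheory.EllipticCurves.KolyvaginHeegnerData Dt β ι n), Squarefree n → (∀ ℓ ∈ n.primeFactors, Literature.NumberTheory.EllipticCurves.Zhang2014.IsKolyvaginPrime (W.conductorNorm ℤ) W K 2 ℓ ∧ 2 ≤ Literature.NumberTheory.EllipticCurves.Zhang2014.kolyvaginIndex W 2 ℓ ∧ ∃ (v : IsDedekindDomain.HeightOneSpectrum (NumberField.RingOfIntegers ℚ)) (𝔓 : Ideal (Literature.NumberTheory.GaloisRepresentations.absIntegers (NumberField.RingOfIntegers ℚ) ℚ)) (h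 : Field.absoluteGaloisGroup ℚ), ((ℓ : ℕ) : NumberField.RingOfIntegers ℚ) ∈ v.asIdeal ∧ 𝔓 ∈ v.primesAbove ∧ IsArithFrobAt (NumberField.RingOfIntegers ℚ) h 𝔓 ∧ ∃ u : W.geomTorsion ((2 : ℕ) : ℤ), h • u ≠ u) → (¬ ∃ Q : (W.baseChange (Literature.NumberTheory.EllipticCurves.ringClassField K ι n)).toAffine.Point, (2 : ℤ) • Q = d.derivedPoint) → 2 ^ (2 * M₀) ∣ Nat.card (AddCommGroup.primaryComponent (W.baseChange K).sha 2) := by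
  intro hQ2 W _ _ _ hcm hT _hpos K _ _ hIQ hodd h3 hHe hsq1 hsq2 hNPh hρ Dt β ι d₁ hy M₀ hdiv hndiv hw Wd _ _ hWd hSel _hTam
    n₀ e₀ hn₀ hKoly he₀
  obtain ⟨τ, hτ, -⟩ := exists_conj_of_isImaginaryQuadratic (K := K) hIQ
  haveI : ∀ j : ℕ, NumberField (ringClassField K ι j) := JET.numberField_ringClassField K hIQ ι
  have hsurN' : ∀ m : ℕ, W.HasSurjectiveModNGaloisRep (2 ^ m : ℕ) := fun m ↦ by
    exact_mod_cast Summit.BirchSwinnertonDyer.BirchSwinnertonDyer.Theorems.MinimalTwinBSDTwo.forall_hasSurjectiveModNGaloisRep_two_pow_of_pos W hρ m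
  -- R⁺: `rank E(K) ≤ 1` on the cut (this seat, `…PosTRankLeOnePosCut`, p758733)
  have hrk : (W.baseChange K).mordellWeilRank ≤ 1 :=
    mordellWeilRank_baseChange_le_one_onPosCut_flat hQ2 W hcm hT K hIQ hodd h3 hHe hsq1 hsq2 hNPh hρ Dt β ι d₁ hy M₀ hndiv hw Wd hWd hSel
  -- the item's witness clause in the Theorems' spelling (`geomTorsion W 2`)
  have hKoly' : ∀ ℓ ∈ n₀.primeFactors, Zhang2014.IsKolyvaginPrime (W.conductorNorm ℤ) W K 2 ℓ ∧ 2 ≤ Zhang2014.kolyvaginIndex W 2 ℓ ∧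
      ∃ (v : HeightOneSpectrum (𝓞 ℚ)) (𝔓 : Ideal (absIntegers (𝓞 ℚ) ℚ)) (h : absoluteGaloisGroup ℚ),
        (ℓ : 𝓞 ℚ) ∈ v.asIdeal ∧ 𝔓 ∈ v.primesAbove ∧ IsArithFrobAt (𝓞 ℚ) h 𝔓 ∧ ∃ u : geomTorsion W 2, h • u ≠ u := by
    intro ℓ hℓ
    obtain ⟨hZ, hidx, v', 𝔓, h, hv', h𝔓, hfr, hu⟩ := hKoly ℓ hℓ
    exact ⟨hZ, hidx, v', 𝔓, h, hv', h𝔓, hfr, exists_smul_ne_two_of_natCast W hu⟩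
  exact pow_dvd_natCard_sha_of_sockets_of_rank_le_one_transposition_flat hQ2 W hcm hT K hIQ hodd h3 hHe hsq1 hsq2 hNPh hρ Dt β ι d₁ hy
    M₀ hdiv hndiv hrk τ hτ
    (exists_transposition_kolyvaginPrime_localization_fullOrder_pair_deep W K hIQ hodd hHe hsurN' τ hτ (2 * (M₀ + 6)) 1 (by omega))
    (GenusExact.TransverseValue.hbot_socket_margin_onHabitat_of_three_le_transposition_flat W hQ2 hcm hT hsurN' hIQ hodd h3 hHe hsq1 hsq2 hNPh
      Dt β ι (L := 2 * (M₀ + 6)) (by omega) 1 (by omega) _ (fun q _ hidx hF ↦ ⟨hidx, hF⟩) hn₀ hKoly' e₀ he₀)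
    (deepSwap_socket_transposition W hcm hT hsurN' hIQ hodd h3 hHe τ hτ Dt β ι hQ2 (M₀ := M₀) (L := 2 * (M₀ + 6)) (k := 1) (by omega) le_rfl
      (hNPh
        (2 * (M₀ + 6) + 1) (by omega)))
    (fun r ℓ hℓ C hC ↦ hK_socket_margin_of_frob_smul_ne W hIQ hτ (L := 2 * (M₀ + 6)) (by omega) r 1 ℓ hℓ C hC)

end Summit.BirchSwinnertonDyer.BirchSwinnertonDyer.Theorems

/-! ## LINE 26 STUB `stub_Q4flat` — VERBATIM -/

namespace Summit.BirchSwinnertonDyer.BirchSwinnertonDyer.Theorems.GenusExact.Lw2PhantomExclusion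

open WeierstrassCurve NumberField IsDedekindDomain Literature.NumberTheory.EllipticCurves
  Literature.NumberTheory.EllipticCurves.ModularForms
open Summit.BirchSwinnertonDyer.BirchSwinnertonDyer.Theses.GenusKolyvaginAtTwo

/-- **LINE 26 «lw2_phantom_exclusion», STUB `stub_Q4flat` — PROVED, signature VERBATIM** (`Cruxes/OffCutResidualAtTwoR/Lines/lw2_phantom_exclusion.lean`):
the landed exactness theorem Q4_T″ `KolyvaginExactAtTwoPosDiscT` (`…Theorems.kolyvaginExactAtTwoPosDiscT_proof`: on the Δ>0 habitat cut with a
transposition-deep Kolyvagin witness, `#Ш(E/K)[2^∞] = 2^(2M₀)`) with its three binders `∀ v, 2 ∉ v → N ∈ v → E multiplicative at v →` REPLACED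
by the hypothesis `(NPh at 2N)(E, K)`, inserted after the two `¬ IsSquare` clauses — `Nat.dvd_antisymm` of the re-threaded U⁺_T′
(`shaCardDvdPowAtTwoPosT_proof_flat`) and L⁺_T′ (`powDvdShaCardAtTwoPosT_proof_flat`).  The skeleton plugs it as
`stub_Q4flat := Summit.BirchSwinnertonDyer.BirchSwinnertonDyer.Theorems.GenusExact.Lw2PhantomExclusion.q4flat`.  UNCONDITIONAL modulo the
in-signature antecedent Q2 `KolyvaginRelationAtTwo`.  BSD is NOT proved by this; the residual crux `OffCutResidualAtTwoR` is NOT closed by this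
(LINE 26 still needs `stub_transport`, `stub_KLW` and keeps `stub_residual`).
[cite: McCallumLMS1991, §5 Thm. 5.4, Cor. 5.6] [cite: Kolyvagin1991StructureSha] [cite: GrossLMS1991, §10] [cite: LawsonWuthrich2016, §4, §8] -/
theorem q4flat :

  KolyvaginRelationAtTwo → ∀ (W : WeierstrassCurve ℚ) [W.IsElliptic] [W.IsGloballyMinimal] [NeZero (W.conductorNorm ℤ)], ¬ W.HasCM → Odd W.tamagawaProduct → 0 < W.Δ → ∀ (K : Type) [Field K] [NumberField K], Literature.NumberTheory.EllipticCurves.IsImaginaryQuadratic K → Odd (NumberField.discr K) → NumberField.discr K ≠ -3 → Literature.NumberTheory.EllipticCurves.SatisfiesHeegnerHypothesis (W.conductorNorm ℤ) K → ¬ IsSquare ((NumberField.discr K : ℚ) * -|W.Δ|) → ¬ IsSquare ((NumberField.discr K : ℚ) * (-(2 * |W.Δ|))) →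
    (∀ (Mlev : ℕ), 1 ≤ Mlev → ∀ z : galH1Torsion (W.baseChange K) ((2 ^ Mlev : ℕ) : ℤ),
          (∀ ρ ∈ torsionFixing (W.baseChange K) ((2 ^ Mlev : ℕ) : ℤ), h1Eval (W.baseChange K) ((2 ^ Mlev : ℕ) : ℤ) z ρ = 0) →
          (∀ w : HeightOneSpectrum (𝓞 K), ((2 * W.conductorNorm ℤ : ℕ) : 𝓞 K) ∈ w.asIdeal →
            z ∈ selmerLocalKer (W.baseChange K) (w.adicCompletion K) ((2 ^ Mlev : ℕ) : ℤ)) → z = 0) → (∀ n : ℕ, 0 < n → W.HasSurjectiveModNGaloisRep ((2 : ℤ) ^ n)) → ∀ (Dt : Literature.NumberTheory.EllipticCurves.ModularForms.ModularParametrizationData W (W.conductorNorm ℤ)) (β : ℤ) (ι : K →+* ℂ) (d₁ : Literature.NumberTheory.EllipticCurves.KolyvaginHeegnerData Dt β ι 1), ¬ IsOfFinAddOrder d₁.derivedPoint → ∀ (M₀ : ℕ), (∃ Q : (W.baseChange (Literature.NumberTheory.EllipticCurves.ringClassField K ι 1)).toAffine.Point, ((2 ^ M₀ : ℕ) : ℤ)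 • Q = d₁.derivedPoint) → (¬ ∃ Q : (W.baseChange (Literature.NumberTheory.EllipticCurves.ringClassField K ι 1)).toAffine.Point, ((2 ^ (M₀ + 1) : ℕ) : ℤ) • Q = d₁.derivedPoint) → W.rootNumber = 1 → ∀ (Wd : WeierstrassCurve ℚ) [Wd.IsElliptic] [Wd.IsGloballyMinimal], (∃ C : WeierstrassCurve.VariableChange ℚ, C • W.quadraticTwist (NumberField.discr K : ℚ) = Wd) → Nat.card (Wd.selmerGroup 2) = 2 → padicValNat 2 Wd.tamagawaProduct = 0 → ∀ (n : ℕ) (d : Literature.NumberTheory.EllipticCurves.KolyvaginHeegnerData Dt β ι n), Squarefree n → (∀ ℓ ∈ n.primeFactors, Literature.NumberTheory.EllipticCurves.Zhang2014.IsKolyvaginPrime (W.conductorNorm ℤ) W K 2 ℓ ∧ 2 ≤ Literature.NumberTheory.EllipticCurves.Zhang2014.kolyvaginIndex W 2 ℓ ∧ ∃ (v : IsDedekindDomain.HeightOneSpectrum (NumberField.RingOfIntegers ℚ)) (𝔓 : Ideal (Literature.NumberTheory.GaloisRepresentations.absIntegers (NumberField.RingOfIntegers ℚ) ℚ)) (h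 : Field.absoluteGaloisGroup ℚ), ((ℓ : ℕ) : NumberField.RingOfIntegers ℚ) ∈ v.asIdeal ∧ 𝔓 ∈ v.primesAbove ∧ IsArithFrobAt (NumberField.RingOfIntegers ℚ) h 𝔓 ∧ ∃ u : W.geomTorsion ((2 : ℕ) : ℤ), h • u ≠ u) → (¬ ∃ Q : (W.baseChange (Literature.NumberTheory.EllipticCurves.ringClassField K ι n)).toAffine.Point, (2 : ℤ) • Q = d.derivedPoint) → Nat.card (AddCommGroup.primaryComponent (W.baseChange K).sha 2) = 2 ^ (2 * M₀) := by
  intro hQ2 W _ _ _ hcm hT hpos K _ _ hIQ hodd h3 hHe hsq1 hsq2 hNPh hρ Dt β ι d₁ hy M₀ hdiv hndiv hw Wd _ _ hWd hSel hTam n d hn hKoly hPn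
  exact Nat.dvd_antisymm
    (shaCardDvdPowAtTwoPosT_proof_flat hQ2 W hcm hT hpos K hIQ hodd h3 hHe hsq1 hsq2 hNPh hρ Dt β ι d₁ hy M₀ hdiv hndiv hw Wd hWd hSel hTam)
    (powDvdShaCardAtTwoPosT_proof_flat hQ2 W hcm hT hpos K hIQ hodd h3 hHe hsq1 hsq2 hNPh hρ Dt β ι d₁ hy M₀ hdiv hndiv hw Wd hWd hSel hTam
      n d hn hKoly hPn)

end Summit.BirchSwinnertonDyer.BirchSwinnertonDyer.Theorems.GenusExact.Lw2PhantomExclusion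

end
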